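import Summits.HubbardSuperconductivity.HubbardSuperconductivity.Theses.SpinStructureRigidity
import Literature.MathematicalPhysics.QuantumLattice.TwistedHoppingPlaneWaves

/-!
# Birth skeleton (BC3) for crux `SpinStructureRigidity.SsrBridge` — stmt-HubbardSuperconductivity-1489

Route `route-HubbardSuperconductivity-SpinStructureRigidity` (sub-problem `HubbardSuperconductivity`), crux of
rank 3, THE NAMED CONDITIONAL BRIDGE: for all `U > 0`, `μ`, `κ₀ > 0`, `n ∈ (3/5, 1)`, if the grand-canonical
density of `hubbardTorusWith 2 L 1 U μ` at `β = κL` tends to `n` (all `κ ≥ κ₀`) and the FLUX HALF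
(R1)+(R2) of `SsrRigidity` holds for the boost-gauge twisted family
`H_L(θ) = dΓ(T_L(θ, μ)) + hubbardTorus 2 L 0 U`, `Z_L(κ; θ) = Re tr e^{-κL H_L(θ)}` — (R1) `Z(θ)/Z(0) ∈
[e^{-C}, e^{C}]` on the pair-invisible fluxes `θ ∈ {0, π}²`, (R2) `Z(θ) ≤ e^{-cL} Z(0)` when some `θᵢ` is
`ε`-far from `πℤ` — then for every `κ ≥ κ₀` the `d_{x²-y²}` pair field has thermal long-range order
`Re ⟨Δ_d† Δ_d⟩_{κL, μ} ≥ c L⁴`, eventually in even `L`.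

Registrar seat `planner-skel-stmt-HubbardSuperconductivity-1489-0`, 2026-08-17 (mode skeleton-register,
re-audit bin REPAIRABLE). Published as `Cruxes/SsrBridge/Lines/birth.lean`.
Lead seat `prover-line-stmt-HubbardSuperconductivity-1489-0`, 2026-08-17 (reshape v1): stub S0 is registered with its
signature spelled in tree vocabulary (`dGamma (twistedOneBody L 0 μ) + hubbardTorus 2 L 0 U = …`, definitionally
`twistedHubbard L U μ 0 = …`) so that its Theorems file states it verbatim without the skeleton-local `twistedHubbard`.

## The cut: IDENTIFY · CONDENSE · SELECT (the crux docstring's own (i)/(ii)/(iii))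

The crux's hypothesis is a statement about RATIOS of twisted partition functions, self-normalised by
the `θ = 0` member of the inline family; its conclusion is about the Gibbs state of the tree's canonical
grand-canonical Hamiltonian `hubbardTorusWith 2 L 1 U μ` and about ONE pairing channel. Three things
must happen, and the skeleton names each:

* `stub_twistedHubbard_zeroFlux : TwistedHubbardZeroFlux` — IDENTIFICATION (size M, provable now).
  For `L ≥ 3` the zero-flux member of the twisted family IS the grand-canonical Hubbard torus:
  `dΓ(twistedOneBody L 0 μ) + hubbardTorus 2 L 0 U = hubbardTorusWith 2 L 1 U μ`. Proof sketch: at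
  `θ = 0` the Peierls phases are `e^0 = 1`; for `L ≥ 3` the two shift indicators `[x = y + eᵢ]`,
  `[y = x + eᵢ]` of `twistedOneBody_apply_orb` never fire together and fire exactly on the edges of
  `fermionTorusGraph 2 L` (`torusGraph_adj_iff`, `ofLex_eq_update_iff`; cf.
  `sum_ite_torusGraph_adj_matrix (hL : 3 ≤ L)`), so `twistedOneBody L 0 μ = hubbardOneBody
  (fermionTorusGraph 2 L) 1 μ`; then `hamiltonianWith_zero_eq_dGamma` (`dΓ h = H(1,0) - μN`) and the
  additive shape of `Hubbard.hamiltonian` (`H(1,0) + H(0,U) = H(1,U)`, `zero_smul`) finish. False for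
  `L ≤ 2` (double-counted bonds / self-loops), hence the hypothesis `3 ≤ L`; the composition absorbs
  it into "eventually in even `L`".
* `stub_stiffnessForcesPairCondensate : StiffnessForcesPairCondensate` — THE OPEN CORE (size XL).
  Flux rigidity normalised by the CANONICAL partition function `Z^{can}_L(κ) = Re tr e^{-κL
  hubbardTorusWith 2 L 1 U μ}` ((R1)+(R2) with `Z(0)` replaced by `Z^{can}`), together with the density
  clause, forces a CHARGE-`2e` CONDENSATE at `β = κL`: for every `κ ≥ κ₀` there are `c > 0`, a range
  `R` and `L₀` such that for all even `L ≥ L₀` some bounded range-`R` pair wavefunction `φ`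
  (`IsLocalPairWF L R φ`: `|φ| ≤ 1`, second orbital within torus distance `R` of the first; ANY spin
  structure, form factor, centre-of-mass texture — channel-blind, as step (ii) of the crux intends)
  has `Re ⟨P_φ† P_φ⟩_{κL, μ} ≥ c L⁴` for Yang's geminal operator `P_φ = pairAnnihilator φ`. This is
  the finite-volume, `β = κL` twin of "superfluid density `> 0` ⇒ condensation", which is NOT a
  theorem (grounder verdict NEW; Lieb–Seiringer–Yngvason 2002 prove the two separately for dilute
  bosons); why it might fail: stiff-but-uncondensed pair liquids (Bose metal, PRB 66 (2002) 054526),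
  and the extra bet made explicit here that the condensate wavefunction keeps non-vanishing weight at
  bounded pair separation `R = R(κ)` as `L → ∞`.
* `stub_repulsiveCondensateSelectsDWave : RepulsiveCondensateSelectsDWave` — `B₁g` SELECTION (size
  L/XL, open). In the PURE REPULSIVE model (`U > 0`) at density `n ∈ (3/5, 1)` (density clause), a
  `β = κL` condensate of some bounded local pair field (the conclusion of the core stub, all
  `κ ≥ κ₀`) is seen by the nearest-neighbour `d_{x²-y²}` pair field: `Re ⟨Δ_d† Δ_d⟩_{κL, μ} ≥ c' L⁴`
  eventually in even `L` (`Δ = pairField dWaveFormFactor L`, the summit's own operator). Why it might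
  fail = the crux's recorded risk (iii): `B₁g`-orthogonal condensates — `d_{xy}`/`p` in the
  weak-coupling corner `n ≈ 0.6⁺` (Raghu–Kivelson–Scalapino 2010 Fig. 2; Šimkovic et al. 2016 §3.1),
  extended-`s`, triplet, PDW/finite-momentum textures (the "named loophole").

Composition `SsrBridge_of : S0 → S1 → S2 → SsrBridge` (hypotheses spelled `__Registered.stub_X`,
`rfl`-aliases keyed by the stub names, for the native skeleton audit) is proved below WITHOUT `sorry`:
the route's `let`-bound flux half is definitionally `FluxRigidity U μ κ₀` (the inline `Matrix.of` is
`twistedOneBody` by `twistedOneBody_eq_inline : … = … := rfl`); S0 rewrites its normaliser `Z(0)` into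
`Z^{can}` for even `L ≥ max L₀ 3`, giving `CanonicalFluxRigidity U μ κ₀`; S1 yields the local pair
condensate and S2 the `d`-wave order, which is the crux's conclusion verbatim. It concludes the route decl
`Summit.HubbardSuperconductivity.HubbardSuperconductivity.Theses.SpinStructureRigidity.SsrBridge` BY NAME.

## Disproof used / negatives / dead lines

None relevant: `ledger crux ls stmt-HubbardSuperconductivity-1489` showed no workfiles (no
`Disproof.lean`, no `Lines/`, no ideas) on 2026-08-17; `ledger negatives --problem HubbardSuperconductivity`
lists two refuted statements (CooperPairDMottWalk breathing self-duality, stmt-1180; AposterioriCapRg KLS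
order openness, stmt-1314), neither about twisted partition functions, Gibbs-state pair correlations or
channel selection, and no stub is an instance of either.

## References

Byers–Yang, PRL 7 (1961) 46; Scalapino–White–Zhang, PRB 47 (1993) 7995 §II [ScalapinoWhiteZhang1993];
Shastry–Sutherland, PRL 65 (1990) 243 [ShastrySutherland1990]; Yang, Rev. Mod. Phys. 34 (1962) 694 §4
[Yang1962]; Scalapino, Phys. Rep. 250 (1995) 329 §2 [Scalapino1995]; Lieb–Seiringer–Yngvason, PRB 66
(2002) 134529 [LiebSeiringerYngvason2002]; Paramekanti–Balents–Fisher, PRB 66 (2002) 054526;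
Raghu–Kivelson–Scalapino, PRB 81 (2010) 224505 [RaghuKivelsonScalapino2010]; Šimkovic et al., PRB 94
(2016) 085106 (arXiv:1512.04271); Koma–Tasaki, J. Stat. Phys. 76 (1994) 745 [KomaTasaki1994];
Benfatto–Giuliani–Mastropietro, AHP 7 (2006) 809 [BenfattoGiulianiMastropietro2006] (`H(t,0) - μN = dΓ h`).
-/

-- `Summit.<Summit>.<Problem>` is the tree's mandated summit-side namespace; single-conjunct summit, duplicate deliberate.
set_option linter.dupNamespace false

noncomputable section

namespace Summit.HubbardSuperconductivity.HubbardSuperconductivity.Cruxes.SsrBridge.Birth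

open Filter Matrix
open Literature.Probability.LatticeModels
open Literature.MathematicalPhysics.QuantumLattice

/-! ## Objects -/

/-- Pair wavefunctions (geminal coefficient vectors, the argument of Yang's `pairAnnihilator`) on the
fermionic torus of side `L`: functions of an ordered pair of Hubbard orbitals `(site, spin)`. -/
abbrev PairWF (L : ℕ) : Type := Orb (FermionTorus 2 L) × Orb (FermionTorus 2 L) → ℂ

/-- **Local (range-`R`, sup-bounded) pair wavefunctions**: `|φ p| ≤ 1` everywhere, and `φ (o₁, o₂) ≠ 0`
only if the site of `o₂` is the site of `o₁` translated by some `e ∈ {-R, …, R}²` on the torus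
(`Torus.proj`). Coefficient vectors of sums `Σ_x Δ_x` of bounded local pair operators: any spin
structure, any form factor of range `≤ R`, any site-dependent phase texture (same notion as in
`Cruxes/FluxBridge/Lines/birth.lean`). -/
def IsLocalPairWF (L R : ℕ) (φ : PairWF L) : Prop :=
  (∀ p, ‖φ p‖ ≤ 1) ∧
    ∀ p, φ p ≠ 0 → ∃ e ∈ box 2 R,
      (ofLex p.2).1.toTorusSite = (ofLex p.1).1.toTorusSite + Torus.proj L e

/-- **The boost-gauge twisted Hubbard torus** `H_L(θ; U, μ) = dΓ(T_L(θ, μ)) + hubbardTorus 2 L 0 U`: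
the route's inline `let H` with the one-body matrix under its Literature name `twistedOneBody L θ μ`
(which is the inline `Matrix.of` by `rfl`, `twistedOneBody_eq_inline`). -/
def twistedHubbard (L : ℕ) [NeZero L] (U μ : ℝ) (θ : Fin 2 → ℝ) :
    Matrix (Finset (Orb (FermionTorus 2 L))) (Finset (Orb (FermionTorus 2 L))) ℂ :=
  dGamma (twistedOneBody L θ μ) + hubbardTorus 2 L 0 U

/-- **The twisted partition function** `Z_L(κ; θ) = Re tr e^{-κL H_L(θ; U, μ)}` at `β = κL`
(temporal structure AP); the route's inline `let Z`. -/
def twistZ (L : ℕ) [NeZero L] (U μ κ : ℝ) (θ : Fin 2 → ℝ) : ℝ :=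
  (partitionFn (κ * L) (twistedHubbard L U μ θ)).re

/-- **The canonical (untwisted) partition function** `Z^{can}_L(κ) = Re tr e^{-κL (H(1,U) - μN)}` of the
tree's grand-canonical Hubbard torus `hubbardTorusWith 2 L 1 U μ` at `β = κL`. -/
def canonicalZ (L : ℕ) (U μ κ : ℝ) : ℝ :=
  (partitionFn (κ * L) (hubbardTorusWith 2 L 1 U μ)).re

/-- **The density clause** of the crux (verbatim): the grand-canonical density of
`hubbardTorusWith 2 L 1 U μ` at `β = κL` tends to `n`, every `κ ≥ κ₀`. -/
def DensityClause (U μ κ₀ n : ℝ) : Prop :=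
  ∀ κ : ℝ, κ₀ ≤ κ → Filter.Tendsto (fun L : ℕ =>
    ((hubbardTorusWith 2 (L + 1) 1 U μ).gibbsState (κ * ((L + 1 : ℕ) : ℝ)) totalNumber).re /
      ((L + 1 : ℕ) : ℝ) ^ 2) Filter.atTop (nhds n)

/-- **The flux half (R1)+(R2) of `SsrRigidity`**, self-normalised by `Z(0)` — definitionally the crux's
`let`-bound hypothesis (the inline `Matrix.of` is `twistedOneBody`, `rfl`). -/
def FluxRigidity (U μ κ₀ : ℝ) : Prop :=
  ∀ κ : ℝ, κ₀ ≤ κ → ∀ ε : ℝ, 0 < ε → ∃ C c : ℝ, 0 < c ∧ ∃ L₀ : ℕ, ∀ (L : ℕ) [NeZero L], Even L → L₀ ≤ L →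
    (∀ θ : Fin 2 → ℝ, (∀ i, θ i = 0 ∨ θ i = Real.pi) →
        Real.exp (-C) * twistZ L U μ κ 0 ≤ twistZ L U μ κ θ ∧
          twistZ L U μ κ θ ≤ Real.exp C * twistZ L U μ κ 0) ∧
      (∀ θ : Fin 2 → ℝ, (∃ i, ∀ m : ℤ, ε ≤ |θ i - m * Real.pi|) →
        twistZ L U μ κ θ ≤ Real.exp (-(c * L)) * twistZ L U μ κ 0)

/-- **Canonically normalised flux rigidity**: (R1)+(R2) with the normaliser `Z(0)` replaced by the
canonical partition function `Z^{can}_L(κ)` of `hubbardTorusWith 2 L 1 U μ` (what (R1)+(R2) become once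
the zero-flux member of the family is identified with the Hubbard torus, stub S0). -/
def CanonicalFluxRigidity (U μ κ₀ : ℝ) : Prop :=
  ∀ κ : ℝ, κ₀ ≤ κ → ∀ ε : ℝ, 0 < ε → ∃ C c : ℝ, 0 < c ∧ ∃ L₀ : ℕ, ∀ (L : ℕ) [NeZero L], Even L → L₀ ≤ L →
    (∀ θ : Fin 2 → ℝ, (∀ i, θ i = 0 ∨ θ i = Real.pi) →
        Real.exp (-C) * canonicalZ L U μ κ ≤ twistZ L U μ κ θ ∧
          twistZ L U μ κ θ ≤ Real.exp C * canonicalZ L U μ κ) ∧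
      (∀ θ : Fin 2 → ℝ, (∃ i, ∀ m : ℤ, ε ≤ |θ i - m * Real.pi|) →
        twistZ L U μ κ θ ≤ Real.exp (-(c * L)) * canonicalZ L U μ κ)

/-- **Thermal condensation of SOME bounded local pair field at `β = κL`**: for every `κ ≥ κ₀` there are
`c > 0`, a range `R` and `L₀` such that for all even `L ≥ L₀` some range-`R` pair wavefunction `φ` with
`|φ| ≤ 1` has `Re ⟨P_φ† P_φ⟩_{κL, μ} ≥ c L⁴` in the Gibbs state of `hubbardTorusWith 2 L 1 U μ`
(`P_φ = pairAnnihilator φ`, Yang's geminal operator; channel-blind). -/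
def HasLocalPairCondensate (U μ κ₀ : ℝ) : Prop :=
  ∀ κ : ℝ, κ₀ ≤ κ → ∃ c : ℝ, 0 < c ∧ ∃ R L₀ : ℕ, ∀ (L : ℕ) [NeZero L], Even L → L₀ ≤ L →
    ∃ φ : PairWF L, IsLocalPairWF L R φ ∧
      c * (L : ℝ) ^ 4 ≤ ((hubbardTorusWith 2 L 1 U μ).gibbsState (κ * L)
        ((pairAnnihilator φ)ᴴ * pairAnnihilator φ)).re

/-- **Thermal `d_{x²-y²}` pair-field long-range order at `β = κL`** (the crux's conclusion, verbatim):
for every `κ ≥ κ₀`, `Re ⟨Δ_d† Δ_d⟩_{κL, μ} ≥ c L⁴` eventually in even `L`,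
`Δ_d = pairField dWaveFormFactor L`. -/
def DWaveThermalLRO (U μ κ₀ : ℝ) : Prop :=
  ∀ κ : ℝ, κ₀ ≤ κ → ∃ c : ℝ, 0 < c ∧ ∃ L₀ : ℕ, ∀ (L : ℕ) [NeZero L], Even L → L₀ ≤ L →
    c * (L : ℝ) ^ 4 ≤ ((hubbardTorusWith 2 L 1 U μ).gibbsState (κ * L)
      ((pairField dWaveFormFactor L)ᴴ * pairField dWaveFormFactor L)).re

/-! ## Stub statements -/

/-- **S0 — the zero-flux member of the twisted family is the grand-canonical Hubbard torus**
(identification, provable now): for `L ≥ 3`,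
`dΓ(twistedOneBody L 0 μ) + hubbardTorus 2 L 0 U = hubbardTorusWith 2 L 1 U μ`.
(False for `L ≤ 2`: the inline shift indicators double-count the bonds of the `L = 2` torus and produce
self-loops at `L = 1`, while `fermionTorusGraph` is simple.) -/
def TwistedHubbardZeroFlux : Prop :=
  ∀ (L : ℕ) [NeZero L], 3 ≤ L → ∀ U μ : ℝ,
    dGamma (twistedOneBody L 0 μ) + hubbardTorus 2 L 0 U = hubbardTorusWith 2 L 1 U μ

/-- **S1 — stiffness forces a charge-`2e` condensate at `β = κL`** (the open core). For all `U > 0`,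
`μ`, `κ₀ > 0`, `n ∈ (3/5, 1)`: the density clause and the canonically normalised flux rigidity
(R1)+(R2) force thermal condensation of some bounded local pair field, every `κ ≥ κ₀`. -/
def StiffnessForcesPairCondensate : Prop :=
  ∀ (U μ κ₀ n : ℝ), 0 < U → 0 < κ₀ → n ∈ Set.Ioo (3 / 5 : ℝ) 1 →
    DensityClause U μ κ₀ n → CanonicalFluxRigidity U μ κ₀ → HasLocalPairCondensate U μ κ₀

/-- **S2 — in the pure repulsive model at density `n ∈ (3/5, 1)` a `β = κL` pair condensate is seen by
the `d_{x²-y²}` pair field** (`B₁g` selection, open). For all `U > 0`, `μ`, `κ₀ > 0`, `n ∈ (3/5, 1)`: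
the density clause and thermal condensation of some bounded local pair field (all `κ ≥ κ₀`) give
thermal `d_{x²-y²}` pair-field LRO `≥ c' L⁴` (all `κ ≥ κ₀`, eventually in even `L`). -/
def RepulsiveCondensateSelectsDWave : Prop :=
  ∀ (U μ κ₀ n : ℝ), 0 < U → 0 < κ₀ → n ∈ Set.Ioo (3 / 5 : ℝ) 1 →
    DensityClause U μ κ₀ n → HasLocalPairCondensate U μ κ₀ → DWaveThermalLRO U μ κ₀

/-! ## Registered stubs -/

/-- stub S0: zero-flux identification `H_L(0; U, μ) = hubbardTorusWith 2 L 1 U μ` for `L ≥ 3`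
(provable now, size M). -/
theorem stub_twistedHubbard_zeroFlux :
    ∀ (L : ℕ) [NeZero L], 3 ≤ L → ∀ U μ : ℝ,
      dGamma (twistedOneBody L 0 μ) + hubbardTorus 2 L 0 U = hubbardTorusWith 2 L 1 U μ := by
  sorry

/-- stub S1: canonically normalised flux rigidity + density ⇒ thermal condensation of some bounded local
pair field at `β = κL` (hardest stub; the open core of the crux). -/
theorem stub_stiffnessForcesPairCondensate : StiffnessForcesPairCondensate := by
  sorry

/-- stub S2: `B₁g` selection — in the repulsive model at density `n ∈ (3/5, 1)` a local pair condensate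
at `β = κL` is seen by the `d_{x²-y²}` pair field (open). -/
theorem stub_repulsiveCondensateSelectsDWave : RepulsiveCondensateSelectsDWave := by
  sorry

/-! ## Name-keyed aliases of the stub statements — the hypotheses of `SsrBridge_of`

The native skeleton audit (`#h21_check_skeleton`) admits a hypothesis of the skeleton theorem only if its
head constant is a registered obligation or is NAMED like a declared stub; `__Registered.stub_X` is the
statement of `stub_X` under that name (device of `Cruxes/FluxBridge/Lines/birth.lean`). Each alias is
`rfl`-equal to its statement. -/
namespace __Registered

/-- Alias of `TwistedHubbardZeroFlux` keyed by the registered stub name. -/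
abbrev stub_twistedHubbard_zeroFlux : Prop := TwistedHubbardZeroFlux
/-- Alias of `StiffnessForcesPairCondensate` keyed by the registered stub name. -/
abbrev stub_stiffnessForcesPairCondensate : Prop := StiffnessForcesPairCondensate
/-- Alias of `RepulsiveCondensateSelectsDWave` keyed by the registered stub name. -/
abbrev stub_repulsiveCondensateSelectsDWave : Prop := RepulsiveCondensateSelectsDWave

end __Registered

/-! ## Composition: the crux BY NAME from the three stub statements (no `sorry` below) -/

/-- The route's `let`-bound flux half at one side `L` IS the named (R1)+(R2) over `twistZ`
(definitional unfolding: `twistedOneBody_eq_inline` is `rfl`). Stated as the conversion used by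
`SsrBridge_of`; proved by `Iff.rfl`-style coercion of the hypothesis. -/
theorem fluxRigidity_of_inline {U μ κ₀ : ℝ}
    (hflux : ∀ κ : ℝ, κ₀ ≤ κ → ∀ ε : ℝ, 0 < ε → ∃ C c : ℝ, 0 < c ∧ ∃ L₀ : ℕ, ∀ (L : ℕ) [NeZero L],
      Even L → L₀ ≤ L →
      let H : (Fin 2 → ℝ) → Matrix (Finset (Orb (FermionTorus 2 L))) (Finset (Orb (FermionTorus 2 L))) ℂ :=
        (fun θ : Fin 2 → ℝ => dGamma (Matrix.of fun o o' : Orb (FermionTorus 2 L) =>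
          (if (ofLex o).2 = (ofLex o').2 then ∑ i : Fin 2,
            ((if ofLex (ofLex o).1 = Function.update (ofLex (ofLex o').1) i (ofLex (ofLex o').1 i + 1)
                then -Complex.exp (Complex.I * ((θ i : ℝ) : ℂ) / (L : ℂ)) else 0) +
              (if ofLex (ofLex o').1 = Function.update (ofLex (ofLex o).1) i (ofLex (ofLex o).1 i + 1)
                then -Complex.exp (-(Complex.I * ((θ i : ℝ) : ℂ) / (L : ℂ))) else 0))
            else 0) - (if o = o' then ((μ : ℝ) : ℂ) else 0)) + hubbardTorus 2 L 0 U);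
      let Z : (Fin 2 → ℝ) → ℝ := fun θ => ((H θ).partitionFn (κ * L)).re;
      (∀ θ : Fin 2 → ℝ, (∀ i, θ i = 0 ∨ θ i = Real.pi) →
          Real.exp (-C) * Z 0 ≤ Z θ ∧ Z θ ≤ Real.exp C * Z 0) ∧
        (∀ θ : Fin 2 → ℝ, (∃ i, ∀ m : ℤ, ε ≤ |θ i - m * Real.pi|) →
          Z θ ≤ Real.exp (-(c * L)) * Z 0)) :
    FluxRigidity U μ κ₀ :=
  hflux

/-- **SsrBridge_of** — identification (S0) × condensation (S1) × selection (S2) ⟹ `SsrBridge`.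
Hypotheses = the three stub statements under their registered names (`__Registered.stub_X` is `X` by
`rfl`); conclusion = the route decl, by name. -/
theorem SsrBridge_of (h0 : __Registered.stub_twistedHubbard_zeroFlux)
    (h1 : __Registered.stub_stiffnessForcesPairCondensate)
    (h2 : __Registered.stub_repulsiveCondensateSelectsDWave) :
    Summit.HubbardSuperconductivity.HubbardSuperconductivity.Theses.SpinStructureRigidity.SsrBridge := by
  intro U μ κ₀ n hU hκ₀ hn hdens hflux
  -- the route's density clause and flux half, under their names (definitional unfolding)
  have hdens' : DensityClause U μ κ₀ n := hdens
  have hflux' : FluxRigidity U μ κ₀ := fluxRigidity_of_inline hflux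
  -- (S0) renormalise (R1)+(R2) by the canonical partition function, for even `L ≥ max L₀ 3`
  have hcan : CanonicalFluxRigidity U μ κ₀ := by
    intro κ hκ ε hε
    obtain ⟨C, c, hc, L₀, hL⟩ := hflux' κ hκ ε hε
    refine ⟨C, c, hc, max L₀ 3, ?_⟩
    intro L _ hE hL₀
    have h3 : 3 ≤ L := le_of_max_le_right hL₀
    have hZ0 : twistZ L U μ κ 0 = canonicalZ L U μ κ := by
      unfold twistZ canonicalZ twistedHubbard
      rw [h0 L h3 U μ]
    have h := @hL L _ hE (le_of_max_le_left hL₀)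
    rw [hZ0] at h
    exact h
  -- (S1) the condensate, (S2) the `d`-wave selection: the crux's conclusion verbatim
  exact h2 U μ κ₀ n hU hκ₀ hn hdens' (h1 U μ κ₀ n hU hκ₀ hn hdens' hcan)

/-- Wiring check (an `example`, so that `SsrBridge_of` stays the only theorem concluding the crux):
the registered stubs feed the skeleton theorem as stated — this term becomes the crux proof when the
three `sorry`s above are discharged (it carries `sorryAx` exactly through the three `stub_*`). -/
example : Summit.HubbardSuperconductivity.HubbardSuperconductivity.Theses.SpinStructureRigidity.SsrBridge :=
  SsrBridge_of stub_twistedHubbard_zeroFlux stub_stiffnessForcesPairCondensate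
    stub_repulsiveCondensateSelectsDWave

/-- The plain-arrow form `<stub sigs> → SsrBridge` of the skeleton theorem (same proof term). -/
example : TwistedHubbardZeroFlux → StiffnessForcesPairCondensate → RepulsiveCondensateSelectsDWave →
    Summit.HubbardSuperconductivity.HubbardSuperconductivity.Theses.SpinStructureRigidity.SsrBridge :=
  SsrBridge_of

end Summit.HubbardSuperconductivity.HubbardSuperconductivity.Cruxes.SsrBridge.Birth

end
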